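import Mathlib
import Literature.AlgebraicGeometry.Resolution.RegularLocalRingsNormal
import Literature.AlgebraicGeometry.Resolution.RegularLocalRingsQuotient
import Literature.RingTheory.KrullDimension.AffineDimension
import Summits.ResolutionOfSingularities.ResolutionOfSingularities.Theorems.RadicialJungCleanModelsSufficeRegularTypeSop
import Summits.ResolutionOfSingularities.ResolutionOfSingularities.Theorems.RadicialJungCleanModelsSufficeKummerOrderStructure

/-!
# Route `RadicialJung`, crux `CleanModelsSuffice`: the Kummer order is integrally closed

Line `Sketch`, skeleton v3, stub `stub_kummerNormal`.

Let `A` be a regular local ring with fraction field `K` of characteristic `p`, `L/K` a field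
extension of degree `p`, and `(t, a, y)` normalised Kummer data: `t_i ∈ A ∖ 0` (`i ≤ m`), `a₀ = 1`,
`1 ≤ a_i < p`, `y ∈ L ∖ K` with `y^p = g := ∏ t_i^{a_i}`, some `t_i ∈ 𝔪_A`, and the `t_i` lying in
`𝔪_A` jointly part of a minimal system of generators of `𝔪_A`. The KUMMER ORDER is
`R := A[z_0, …, z_{p-1}] ⊆ L`, `z_j = y^j / T_j`, `T_j = ∏_i t_i^{⌊j a_i/p⌋}`.

`stub_kummerNormal`: `R` is integrally closed, GIVEN the ring-level descent (hypothesis `hKD`, the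
statement of the sibling theorem `stub_kummerDescent`): "if `Σ_j κ_j^p g^j ∈ A` (`κ_j ∈ K`) then
`κ_j T_j ∈ A` for all `j`".

Proof. By `stub_kummerOrderStructure`, `R = ⊕_j A z_j` is module-finite over `A` with
`Frac R = L`, so it suffices (`isIntegrallyClosed_iff`) to put every `x ∈ L` integral over `R`
into `R`. Such an `x` is integral over `A` (`isIntegral_trans`). Write `x = Σ_j κ_j y^j` in the
`K`-basis `1, y, …, y^{p-1}` of `L` (`linearIndependent_pow_of_pth_root` and `[L:K] = p`). By
Frobenius in characteristic `p`, `x^p = Σ_j κ_j^p g^j ∈ K` is integral over `A`, hence lies in `A`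
because a regular local ring is normal (`isIntegrallyClosed_of_isRegularLocalRing`, Matsumura
Thm. 19.4). The descent gives `κ_j T_j =: r_j ∈ A`, and then
`x = Σ κ_j y^j = Σ r_j z_j ∈ ⊕ A z_j = R`.

Sources: folklore (the computation behind K. Kato, *Toric singularities*, Amer. J. Math. 116
(1994), (4.1) "log regular ⇒ normal", in the special case of a Kummer covering of a regular
local ring, which is all the line `Sketch` uses).

Not here: the descent itself (`stub_kummerDescent`, file
`RadicialJungCleanModelsSufficeKummerDescent.lean`) and the structure of the Kummer order
(`RadicialJungCleanModelsSufficeKummerOrderStructure.lean`).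
-/

noncomputable section

set_option linter.dupNamespace false -- mandated namespace of this single-conjunct summit

open IsLocalRing

namespace Summit.ResolutionOfSingularities.ResolutionOfSingularities.Theorems.RadicialJung.CleanModelsSuffice

/-- STUB (the Kummer order is integrally closed — the special case of Kato 1994 (4.1) the line uses,
from `stub_kummerDescent`). Let `A` be a regular local ring with fraction field `K` of characteristic `p`,
`L/K` of degree `p`, `(t, a, y)` normalised Kummer data (`a₀ = 1`, `1 ≤ a_i < p`, `t_i ≠ 0`, `y ∉ K`,
`y^p = ∏ t_i^{a_i}`) with some `t_i ∈ 𝔪_A` and those in `𝔪_A` jointly part of a minimal system of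
generators. Then the Kummer order `A[z_j]`, `z_j = y^j/∏ t_i^{⌊j a_i/p⌋}`, is integrally closed: an element
`x = Σ κ_j y^j` of `L = Frac A[z]` integral over `A[z]` is integral over `A`, so `x^p = Σ κ_j^p g^j ∈ A`
(`A` is normal), and the descent puts `x` in `⊕ A z_j = A[z]` (`stub_kummerOrderStructure`). [folklore] -/
theorem stub_kummerNormal
    (hKD : ∀ {A K : Type} [CommRing A] [IsRegularLocalRing A] [Field K] [Algebra A K]
      [IsFractionRing A K] (p : ℕ) (_ : p.Prime) [CharP K p] (m : ℕ) (t : Fin (m + 1) → A)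
      (_ : ∀ i, t i ≠ 0) (a : Fin (m + 1) → ℕ) (_ : ∀ i, ¬ p ∣ a i) (_ : ∃ i, t i ∈ maximalIdeal A)
      (_ : ∃ (d : ℕ) (tw : Fin d → A) (ι : Fin (m + 1) → Fin d),
        Ideal.span (Set.range tw) = maximalIdeal A ∧ ringKrullDim A = (d : WithBot ℕ∞) ∧
        (∀ i, t i ∈ maximalIdeal A → tw (ι i) = t i) ∧
        (∀ i j, t i ∈ maximalIdeal A → t j ∈ maximalIdeal A → ι i = ι j → i = j))
      (κ : Fin p → K)
      (_ : ∑ j : Fin p, κ j ^ p * algebraMap A K (∏ i, t i ^ a i) ^ (j : ℕ) ∈ (algebraMap A K).range),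
      ∀ j : Fin p, κ j * algebraMap A K (∏ i, t i ^ ((j : ℕ) * a i / p)) ∈ (algebraMap A K).range)
    {A K L : Type} [CommRing A] [IsRegularLocalRing A] [Field K]
    [Algebra A K] [IsFractionRing A K] [Field L] [Algebra K L] [Algebra A L] [IsScalarTower A K L]
    (p : ℕ) (hp : p.Prime) [CharP K p] (hdeg : Module.finrank K L = p) (m : ℕ)
    (t : Fin (m + 1) → A) (ht : ∀ i, t i ≠ 0) (a : Fin (m + 1) → ℕ) (ha0 : a 0 = 1)
    (ha : ∀ i, 1 ≤ a i ∧ a i < p) (y : L) (hy : y ∉ Set.range (algebraMap K L))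
    (hyp : y ^ p = algebraMap A L (∏ i, t i ^ a i))
    (hSne : ∃ i, t i ∈ maximalIdeal A)
    (hsop : ∃ (d : ℕ) (tw : Fin d → A) (ι : Fin (m + 1) → Fin d),
      Ideal.span (Set.range tw) = maximalIdeal A ∧ ringKrullDim A = (d : WithBot ℕ∞) ∧
      (∀ i, t i ∈ maximalIdeal A → tw (ι i) = t i) ∧
      (∀ i j, t i ∈ maximalIdeal A → t j ∈ maximalIdeal A → ι i = ι j → i = j)) :
    IsIntegrallyClosed (Algebra.adjoin A (Set.range fun j : Fin p =>
      y ^ (j : ℕ) / algebraMap A L (∏ i, t i ^ ((j : ℕ) * a i / p)))) := by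
  set z : Fin p → L := fun j => y ^ (j : ℕ) / algebraMap A L (∏ i, t i ^ ((j : ℕ) * a i / p))
    with hz
  have hzj : ∀ j, z j = y ^ (j : ℕ) / algebraMap A L (∏ i, t i ^ ((j : ℕ) * a i / p)) :=
    fun j => congrFun hz j
  obtain ⟨hspanR, -, hfin, -, hfrac⟩ :=
    stub_kummerOrderStructure p hp hdeg m t ht a ha0 ha y hy hyp z hzj
  haveI := hfin
  haveI := hfrac
  haveI : Fact p.Prime := ⟨hp⟩
  haveI : NeZero p := ⟨hp.ne_zero⟩
  haveI : CharP L p := charP_of_injective_algebraMap (algebraMap K L).injective p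
  haveI : IsDomain A := Literature.AlgebraicGeometry.Resolution.isDomain_of_isRegularLocalRing A
  haveI : IsIntegrallyClosed A :=
    Literature.AlgebraicGeometry.Resolution.isIntegrallyClosed_of_isRegularLocalRing A
  have hinj : Function.Injective (algebraMap A L) :=
    algebraMap_injective_of_isFractionRing_tower K
  have hD : ∀ f : Fin (m + 1) → ℕ, algebraMap A L (∏ i, t i ^ f i) ≠ 0 := by
    intro f
    rw [map_prod]
    exact Finset.prod_ne_zero_iff.mpr fun i _ => by
      rw [map_pow]
      exact pow_ne_zero _ ((map_ne_zero_iff _ hinj).mpr (ht i))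
  -- the `K`-basis `1, y, …, y^{p-1}` of `L`
  have hliK : LinearIndependent K fun j : Fin p => y ^ (j : ℕ) :=
    linearIndependent_pow_of_pth_root p hp _ y hy hyp
  have hcard : Fintype.card (Fin p) = Module.finrank K L := by
    rw [Fintype.card_fin, hdeg]
  let b : Module.Basis (Fin p) K L := basisOfLinearIndependentOfCardEqFinrank hliK hcard
  have hb : ∀ j, b j = y ^ (j : ℕ) := fun j =>
    congrFun (coe_basisOfLinearIndependentOfCardEqFinrank hliK hcard) j
  -- an element of `L = Frac R` integral over `R` lies in `R`
  refine (isIntegrallyClosed_iff L).mpr fun {x} hx => ?_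
  have hxA : IsIntegral A x := isIntegral_trans x hx
  obtain ⟨κ, hκ⟩ : ∃ κ : Fin p → K, x = ∑ j, κ j • y ^ (j : ℕ) := by
    refine ⟨b.repr x, ?_⟩
    conv_lhs => rw [← b.sum_repr x]
    exact Finset.sum_congr rfl fun j _ => by rw [hb]
  -- `x^p = Σ κ_j^p g^j ∈ K`, integral over the normal ring `A`, hence in `A`
  have hxp : x ^ p =
      algebraMap K L (∑ j, κ j ^ p * algebraMap A K (∏ i, t i ^ a i) ^ (j : ℕ)) := by
    rw [hκ, sum_pow_char p, map_sum]
    refine Finset.sum_congr rfl fun j _ => ?_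
    rw [smul_pow, ← pow_mul, mul_comm (j : ℕ) p, pow_mul, hyp]
    simp only [Algebra.smul_def, map_mul, map_pow, ← IsScalarTower.algebraMap_apply]
  have hF : ∑ j, κ j ^ p * algebraMap A K (∏ i, t i ^ a i) ^ (j : ℕ) ∈
      (algebraMap A K).range := by
    have h1 : IsIntegral A (∑ j, κ j ^ p * algebraMap A K (∏ i, t i ^ a i) ^ (j : ℕ)) := by
      refine (isIntegral_algHom_iff (IsScalarTower.toAlgHom A K L)
        (algebraMap K L).injective).mp ?_
      rw [IsScalarTower.toAlgHom_apply, ← hxp]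
      exact hxA.pow p
    obtain ⟨c, hc⟩ := IsIntegrallyClosed.algebraMap_eq_of_integral h1
    exact RingHom.mem_range.mpr ⟨c, hc⟩
  -- the descent: `κ_j T_j = r_j ∈ A`
  have hndvd : ∀ i, ¬ p ∣ a i := fun i h =>
    absurd (Nat.le_of_dvd (ha i).1 h) (not_le.mpr (ha i).2)
  have hdesc := hKD p hp m t ht a hndvd hSne hsop κ hF
  choose r hr using fun j => RingHom.mem_range.mp (hdesc j)
  -- `x = Σ r_j z_j ∈ R`
  have hxz : x = ∑ j, r j • z j := by
    rw [hκ]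
    refine Finset.sum_congr rfl fun j _ => ?_
    rw [hzj, Algebra.smul_def, Algebra.smul_def, IsScalarTower.algebraMap_apply A K L (r j), hr,
      map_mul, ← IsScalarTower.algebraMap_apply A K L, mul_assoc, ← mul_div_assoc,
      mul_div_cancel_left₀ _ (hD _)]
  have hxR : x ∈ Algebra.adjoin A (Set.range z) := by
    rw [← Subalgebra.mem_toSubmodule, hspanR, hxz]
    exact Submodule.sum_mem _ fun j _ =>
      Submodule.smul_mem _ _ (Submodule.subset_span ⟨j, rfl⟩)
  exact ⟨⟨x, hxR⟩, rfl⟩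

end Summit.ResolutionOfSingularities.ResolutionOfSingularities.Theorems.RadicialJung.CleanModelsSuffice

end
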